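import Summits.Ventures.PercRepro.SixFourT2
import Summits.Ventures.PercRepro.PlaneCore

/-!
# PercRepro — C-025 at `(6,4)`: the per-solid balance at the types `t ≤ 2` for EVERY rank-`4` set (p3, gen 9)

mine-2's `MINE2-RLS.md` §21.2 (`t ≤ 1`, «trivial, every `g`») and §21.3 (`t = 2`, every solid, every `g ≥ 4`; the
`g ≤ 8` branch through the demand bonus), in the coloop vocabulary of `SixFourIdentities.lean` and with the
machinery of `SixFourT2.lean`:

* `t = 0`: `DF₀ = 0` and `6 w_∞ ≥ 6/5` on every rank-`4` set (`w_∞ ≥ 1/5`): `J_zero_nonneg`;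
* `t = 1`: `DF₁ ≥ 1` (`G` itself), `σ₁ := 5 w_∞ − 6/5 = −1/5` on an independent `4`-set and `≥ 7/15` on every
  rank-`4` set with `≥ 5` points; the double count `(g − 4)·I₄ = Σ_{|C| = 5} i₄(C) ≤ 5·N₅` gives
  `Σ σ₁ ≥ −I₄/5 + (7/75)(g − 4)·I₄`, which with `I₄ ≤ C(g, 4)` for `g ≤ 6` is `≥ −6/5`: `J_one_nonneg`;
* `t = 2`: `g ≥ 9` is `J_two_nonneg_of_nine_le`; for `g ≤ 8` the demand-free sets contain `G` and the `g − m(G)`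
  sets `G ∖ {a}` with `a` not a coloop of `M|G` (`DF_two_ge`: `DF₂ ≥ g − m(G) + 1 ≥ g − 1` for `g ≥ 5`, since
  `m(G) ≤ 2`), and the general bound `Σ σ ≥ I₄·(−2/5 + (2/45)(g − 4) + (1/45)C(g − 4, 2))` (`sum_sigma_ge`, the
  classes of §21.3) with `I₄ ≤ C(g, 4)` closes each `g = 4, …, 8` by hand: `J_two_nonneg`.

With `SixFourRule.lean` these are the per-solid inequalities of every solid of type `t ≤ 2`.
-/

namespace PercRepro.SixFour

open Finset ThmH

variable {α : Type*} [DecidableEq α] {M : Matroid α} [M.Finite] {G : Finset α}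

/-! ## Values of `w_∞`, and `I₄ ≤ C(g, 4)` -/

/-- `w_∞ ≥ 1/5` on every rank-`4` subset of a simple matroid (`m ≤ 4`). -/
theorem wInf_ge_one_fifth (hs : Simple M) {B : Finset α} (hB : B ⊆ gr M) (hr : M.eRk (B : Set α) = 4) :
    1 / 5 ≤ wInf M B := by
  unfold wInf
  have hm : (mTr M B : ℚ) ≤ 4 := by
    rcases mTr_eq_four_or_le_two hs hB hr with ⟨-, h⟩ | ⟨-, h⟩
    · rw [h]
      norm_num
    · exact_mod_cast h.trans (by norm_num)
  exact one_div_le_one_div_of_le (by positivity) (by linarith)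

/-- `w_∞ = 1/5` on an independent `4`-set. -/
theorem wInf_eq_of_card_four {B : Finset α} (hr : M.eRk (B : Set α) = 4) (hc : B.card = 4) :
    wInf M B = 1 / 5 := by
  unfold wInf
  rw [mTr_eq_four_of_card_eq_four hr hc]
  norm_num

/-- `w_∞ ≥ 1/3` on a rank-`4` set with at least `5` points (`m ≤ 2`). -/
theorem wInf_ge_of_five_le (hs : Simple M) {B : Finset α} (hB : B ⊆ gr M) (hr : M.eRk (B : Set α) = 4)
    (h5 : 5 ≤ B.card) : 1 / 3 ≤ wInf M B := by
  unfold wInf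
  have hm : (mTr M B : ℚ) ≤ 2 := by exact_mod_cast mTr_le_two_of_five_le hs hB hr h5
  exact one_div_le_one_div_of_le (by positivity) (by linarith)

omit [DecidableEq α] in
/-- `I₄ ≤ C(g, 4)`. -/
theorem I4_le_choose (G : Finset α) : I4 M G ≤ G.card.choose 4 := by
  unfold I4
  rw [← Finset.card_powersetCard 4 G]
  apply Finset.card_le_card
  intro B hB
  rw [Finset.mem_filter, mem_R4] at hB
  rw [Finset.mem_powersetCard]
  exact ⟨hB.1.1, hB.2⟩

/-! ## `t = 0` -/

/-- No rank-`4` set is demand-free at `t = 0`. -/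
theorem DF_zero (G : Finset α) : DF M G 0 = 0 := by
  unfold DF
  rw [Finset.card_eq_zero, Finset.filter_eq_empty_iff]
  intro B _ h
  obtain ⟨k, hk, -⟩ := eRk_eq_nat M (G \ B)
  rw [hk] at h
  have h' : ((k + 1 : ℕ) : ℕ∞) ≤ ((0 : ℕ) : ℕ∞) := by
    push_cast
    exact h
  have := (Nat.cast_le (α := ℕ∞)).1 h'
  omega

/-- **`(J₀^∞)` for every rank-`4` set**: `0 ≤ J M G 0` (`6 w_∞ ≥ 6/5`). -/
theorem J_zero_nonneg (hs : Simple M) (hG : G ⊆ gr M) : 0 ≤ J M G 0 := by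
  unfold J
  rw [DF_zero]
  have h : (6 / 5 : ℚ) * (N4 M G : ℚ) ≤ ∑ B ∈ R4 M G, ((6 : ℚ) - ((0 : ℕ) : ℚ)) * wInf M B := by
    calc (6 / 5 : ℚ) * (N4 M G : ℚ) = ∑ _B ∈ R4 M G, (6 / 5 : ℚ) := by
          rw [Finset.sum_const, nsmul_eq_mul]
          unfold N4
          ring
      _ ≤ ∑ B ∈ R4 M G, ((6 : ℚ) - ((0 : ℕ) : ℚ)) * wInf M B := by
          apply Finset.sum_le_sum
          intro B hB
          rw [mem_R4] at hB
          have := wInf_ge_one_fifth hs (hB.1.trans hG) hB.2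
          simp only [Nat.cast_zero, sub_zero]
          linarith
  push_cast
  linarith

/-! ## `t = 1` -/

/-- `σ₁(B) = 5 w_∞(B) − 6/5`, the per-set balance at `t = 1`. -/
noncomputable def sigma1 (M : Matroid α) [M.Finite] (B : Finset α) : ℚ := 5 * wInf M B - 6 / 5

/-- `σ₁ = −1/5` on an independent `4`-set. -/
theorem sigma1_eq_of_card_four {B : Finset α} (hr : M.eRk (B : Set α) = 4) (hc : B.card = 4) :
    sigma1 M B = -1 / 5 := by
  unfold sigma1
  rw [wInf_eq_of_card_four hr hc]
  norm_num

/-- `σ₁ ≥ 7/15` on a rank-`4` set with at least `5` points. -/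
theorem sigma1_ge_of_five_le (hs : Simple M) {B : Finset α} (hB : B ⊆ gr M) (hr : M.eRk (B : Set α) = 4)
    (h5 : 5 ≤ B.card) : 7 / 15 ≤ sigma1 M B := by
  unfold sigma1
  have := wInf_ge_of_five_le hs hB hr h5
  linarith

/-- `G` itself is demand-free at `t = 1`: `1 ≤ DF₁`. -/
theorem one_le_DF_one (hr : M.eRk (G : Set α) = 4) : 1 ≤ DF M G 1 := by
  unfold DF
  apply Finset.card_pos.2
  refine ⟨G, ?_⟩
  rw [Finset.mem_filter, mem_R4]
  refine ⟨⟨Finset.Subset.refl _, hr⟩, ?_⟩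
  rw [Finset.sdiff_self, Finset.coe_empty, M.eRk_empty]
  exact le_rfl

/-- The double count at `|C| = 5`: `(g − 4)·I₄ = Σ_{|C| = 5} i₄(C) ≤ 5·N₅` (a rank-`4` `5`-set contains at most
`5` independent `4`-subsets). -/
theorem choose_one_mul_I4_le (hr : M.eRk (G : Set α) = 4) :
    (G.card - 4).choose 1 * I4 M G ≤ ((R4 M G).filter (fun B : Finset α => B.card = 5)).card * 5 := by
  rw [← sum_i4_eq hr (by norm_num : 4 ≤ 5)]
  have h := Finset.sum_le_card_nsmul ((R4 M G).filter (fun B : Finset α => B.card = 5))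
    (fun C => i4 M C) 5 ?_
  · rw [smul_eq_mul] at h
    exact h
  · intro C hC
    have hc := (Finset.mem_filter.1 hC).2
    have h := i4_le_choose (M := M) C
    rw [hc] at h
    exact h.trans (by decide)

/-- `Σ_{R₄} σ₁ ≥ −I₄/5 + (7/15)·N₅` (the four size classes). -/
theorem sum_sigma1_ge (hs : Simple M) (hG : G ⊆ gr M) :
    -(1 / 5 : ℚ) * (I4 M G : ℚ) +
      (7 / 15 : ℚ) * (((R4 M G).filter (fun B : Finset α => B.card = 5)).card : ℚ) ≤
      ∑ B ∈ R4 M G, sigma1 M B := by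
  rw [sum_R4_split]
  have h4 : ∑ B ∈ (R4 M G).filter (fun B : Finset α => B.card = 4), sigma1 M B =
      -(1 / 5 : ℚ) * (I4 M G : ℚ) := by
    rw [Finset.sum_congr rfl (fun B hB => sigma1_eq_of_card_four (mem_R4.1 (Finset.mem_filter.1 hB).1).2
      (Finset.mem_filter.1 hB).2), Finset.sum_const, nsmul_eq_mul]
    unfold I4
    ring
  have h5 : (7 / 15 : ℚ) * (((R4 M G).filter (fun B : Finset α => B.card = 5)).card : ℚ) ≤
      ∑ B ∈ (R4 M G).filter (fun B : Finset α => B.card = 5), sigma1 M B := by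
    have := Finset.sum_le_sum (s := (R4 M G).filter (fun B : Finset α => B.card = 5))
      (f := fun _ => (7 / 15 : ℚ)) (fun B hB => sigma1_ge_of_five_le hs
      ((mem_R4.1 (Finset.mem_filter.1 hB).1).1.trans hG) (mem_R4.1 (Finset.mem_filter.1 hB).1).2
      (by have h := (Finset.mem_filter.1 hB).2; omega))
    rw [Finset.sum_const, nsmul_eq_mul, mul_comm] at this
    exact this
  have h6 : 0 ≤ ∑ B ∈ (R4 M G).filter (fun B : Finset α => B.card = 6), sigma1 M B :=
    Finset.sum_nonneg (fun B hB => le_trans (by norm_num) (sigma1_ge_of_five_le hs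
      ((mem_R4.1 (Finset.mem_filter.1 hB).1).1.trans hG) (mem_R4.1 (Finset.mem_filter.1 hB).1).2
      (by have := (Finset.mem_filter.1 hB).2; omega)))
  have h7 : 0 ≤ ∑ B ∈ (R4 M G).filter (fun B : Finset α => 7 ≤ B.card), sigma1 M B :=
    Finset.sum_nonneg (fun B hB => le_trans (by norm_num) (sigma1_ge_of_five_le hs
      ((mem_R4.1 (Finset.mem_filter.1 hB).1).1.trans hG) (mem_R4.1 (Finset.mem_filter.1 hB).1).2
      (by have := (Finset.mem_filter.1 hB).2; omega)))
  linarith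

/-- `J₁ = Σ σ₁ + (6/5)·DF₁`. -/
theorem J_one_eq (G : Finset α) : J M G 1 = (∑ B ∈ R4 M G, sigma1 M B) + 6 / 5 * (DF M G 1 : ℚ) := by
  unfold J sigma1 N4
  rw [Finset.sum_sub_distrib, Finset.sum_const, nsmul_eq_mul]
  push_cast
  ring

/-- **`(J₁^∞)` for every rank-`4` set** (mine-2 §21.2, `t = 1`): `0 ≤ J M G 1`. -/
theorem J_one_nonneg (hs : Simple M) (hG : G ⊆ gr M) (hr : M.eRk (G : Set α) = 4) : 0 ≤ J M G 1 := by
  rw [J_one_eq]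
  have hsum := sum_sigma1_ge hs hG
  have hN5 := choose_one_mul_I4_le (M := M) hr
  have hDF := one_le_DF_one (M := M) hr
  have hI := I4_le_choose (M := M) G
  have hg4 := four_le_card_of_eRk_eq_four hr
  obtain ⟨c, hc⟩ : ∃ c, G.card = c + 4 := ⟨G.card - 4, by omega⟩
  rw [hc, Nat.add_sub_cancel, Nat.choose_one_right] at hN5
  rw [hc] at hI
  set N5 := ((R4 M G).filter (fun B : Finset α => B.card = 5)).card with hN5def
  have hN5' : (c : ℚ) * (I4 M G : ℚ) ≤ (N5 : ℚ) * 5 := by exact_mod_cast hN5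
  have hDF' : (1 : ℚ) ≤ DF M G 1 := by exact_mod_cast hDF
  have hI0 : (0 : ℚ) ≤ I4 M G := Nat.cast_nonneg _
  have hN50 : (0 : ℚ) ≤ N5 := Nat.cast_nonneg _
  rcases (show 3 ≤ c ∨ c = 0 ∨ c = 1 ∨ c = 2 by omega) with h3 | h0 | h1 | h2
  · have hc' : (3 : ℚ) ≤ c := by exact_mod_cast h3
    have := mul_le_mul_of_nonneg_right hc' hI0
    linarith
  · subst h0
    have hI' : (I4 M G : ℚ) ≤ 1 := by exact_mod_cast hI.trans (by decide)
    linarith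
  · subst h1
    have hI' : (I4 M G : ℚ) ≤ 5 := by exact_mod_cast hI.trans (by decide)
    push_cast at hN5'
    linarith
  · subst h2
    have hI' : (I4 M G : ℚ) ≤ 15 := by exact_mod_cast hI.trans (by decide)
    push_cast at hN5'
    linarith

/-! ## `t = 2`, every `g ≥ 4` -/

/-- The general lower bound of mine-2 §21.3 (iii), valid for every `g`:
`Σ_{R₄} σ ≥ I₄·(−2/5 + (2/45)·C(g − 4, 1) + (1/45)·C(g − 4, 2))`. -/
theorem sum_sigma_ge (hs : Simple M) (hG : G ⊆ gr M) (hr : M.eRk (G : Set α) = 4) :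
    (I4 M G : ℚ) * (-2 / 5 + 2 / 45 * (((G.card - 4).choose 1 : ℕ) : ℚ) +
      1 / 45 * (((G.card - 4).choose 2 : ℕ) : ℚ)) ≤ ∑ B ∈ R4 M G, sigma M B := by
  rw [sum_R4_split]
  have h4 : ∑ B ∈ (R4 M G).filter (fun B : Finset α => B.card = 4), sigma M B = -2 / 5 * (I4 M G : ℚ) := by
    rw [Finset.sum_congr rfl (fun B hB => sigma_eq_of_card_four (mem_R4.1 (Finset.mem_filter.1 hB).1).2
      (Finset.mem_filter.1 hB).2), Finset.sum_const, nsmul_eq_mul]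
    unfold I4
    ring
  have h5 : (2 / 45 : ℚ) * (((G.card - 4).choose 1 : ℕ) : ℚ) * (I4 M G : ℚ) ≤
      ∑ B ∈ (R4 M G).filter (fun B : Finset α => B.card = 5), sigma M B := by
    have := Finset.sum_le_sum (fun B hB => sigma_ge_of_card_five hs ((mem_R4.1 (Finset.mem_filter.1 hB).1).1.trans hG)
      (mem_R4.1 (Finset.mem_filter.1 hB).1).2 (Finset.mem_filter.1 hB).2)
    rw [← Finset.mul_sum, ← Nat.cast_sum, sum_i4_eq hr (by norm_num : 4 ≤ 5), Nat.cast_mul] at this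
    rw [mul_assoc]
    exact this
  have h6 : (1 / 45 : ℚ) * (((G.card - 4).choose 2 : ℕ) : ℚ) * (I4 M G : ℚ) ≤
      ∑ B ∈ (R4 M G).filter (fun B : Finset α => B.card = 6), sigma M B := by
    have := Finset.sum_le_sum (fun B hB => sigma_ge_of_card_six hs ((mem_R4.1 (Finset.mem_filter.1 hB).1).1.trans hG)
      (mem_R4.1 (Finset.mem_filter.1 hB).1).2 (Finset.mem_filter.1 hB).2)
    rw [← Finset.mul_sum, ← Nat.cast_sum, sum_i4_eq hr (by norm_num : 4 ≤ 6), Nat.cast_mul] at this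
    rw [mul_assoc]
    exact this
  have h7 : 0 ≤ ∑ B ∈ (R4 M G).filter (fun B : Finset α => 7 ≤ B.card), sigma M B :=
    Finset.sum_nonneg (fun B hB => le_trans (by norm_num) (sigma_ge_of_five_le hs
      ((mem_R4.1 (Finset.mem_filter.1 hB).1).1.trans hG) (mem_R4.1 (Finset.mem_filter.1 hB).1).2
      (by have := (Finset.mem_filter.1 hB).2; omega)))
  linarith

/-- **The demand-free sets at `t = 2`** contain `G` and every `G ∖ {a}` with `a` not a coloop of `M|G`:
`g − m(G) + 1 ≤ DF₂`. -/
theorem DF_two_ge (hG : G ⊆ gr M) (hr : M.eRk (G : Set α) = 4) : G.card - mTr M G + 1 ≤ DF M G 2 := by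
  unfold DF
  have hsub : insert G ((G \ coloopsOf M G).image (fun a => G.erase a)) ⊆
      (R4 M G).filter (fun B : Finset α => M.eRk ((G \ B : Finset α) : Set α) + 1 ≤ ((2 : ℕ) : ℕ∞)) := by
    intro B hB
    rw [Finset.mem_insert, Finset.mem_image] at hB
    rw [Finset.mem_filter, mem_R4]
    rcases hB with rfl | ⟨a, ha, rfl⟩
    · refine ⟨⟨Finset.Subset.refl _, hr⟩, ?_⟩
      rw [Finset.sdiff_self, Finset.coe_empty, M.eRk_empty]
      exact_mod_cast (by norm_num : (0 : ℕ) + 1 ≤ 2)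
    · rw [Finset.mem_sdiff] at ha
      obtain ⟨haG, hacol⟩ := ha
      have hcl : a ∈ M.closure ((G.erase a : Finset α) : Set α) := by
        by_contra h
        exact hacol (mem_coloopsOf.2 ⟨haG, h⟩)
      have hr' : M.eRk ((G.erase a : Finset α) : Set α) = 4 := by
        have h1 : M.eRk ((insert a (G.erase a) : Finset α) : Set α) =
            M.eRk ((G.erase a : Finset α) : Set α) := by
          rw [Finset.coe_insert]
          exact eRk_insert_eq_of_mem_closure' hcl
        rw [Finset.insert_erase haG, hr] at h1
        exact h1.symm
      refine ⟨⟨Finset.erase_subset a G, hr'⟩, ?_⟩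
      rw [Finset.sdiff_erase_self haG, Finset.coe_singleton]
      have h1 := M.eRk_singleton_le a
      obtain ⟨k, hk, -⟩ := eRk_eq_nat M {a}
      rw [Finset.coe_singleton] at hk
      rw [hk] at h1 ⊢
      have hk1 : k ≤ 1 := by exact_mod_cast h1
      exact_mod_cast (by omega : k + 1 ≤ 2)
  have hcard := Finset.card_le_card hsub
  have hnot : G ∉ (G \ coloopsOf M G).image (fun a => G.erase a) := by
    intro h
    rw [Finset.mem_image] at h
    obtain ⟨a, ha, hae⟩ := h
    have haG : a ∈ G := (Finset.mem_sdiff.1 ha).1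
    have := Finset.card_erase_of_mem haG
    rw [hae] at this
    have hpos : 0 < G.card := Finset.card_pos.2 ⟨a, haG⟩
    omega
  have hcol : coloopsOf M G ⊆ G := by
    unfold coloopsOf
    exact Finset.filter_subset _ _
  rw [Finset.card_insert_of_notMem hnot, Finset.card_image_of_injOn
    ((erase_injOn G).mono (Finset.coe_subset.2 Finset.sdiff_subset)),
    Finset.card_sdiff_of_subset hcol] at hcard
  unfold mTr
  exact hcard

/-- `J₂ = Σ σ + (6/5)·DF₂`. -/
theorem J_two_eq' (G : Finset α) : J M G 2 = (∑ B ∈ R4 M G, sigma M B) + 6 / 5 * (DF M G 2 : ℚ) := by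
  rw [sum_sigma_eq]
  unfold J
  push_cast
  ring

/-- **`(J₂^∞)` for every rank-`4` set** (mine-2 Theorem 21.3, every `g ≥ 4`): `0 ≤ J M G 2` — `g ≥ 9` by
`J_two_nonneg_of_nine_le`, `g ≤ 8` by the demand bonus `DF₂ ≥ g − m(G) + 1` and the general class bound. -/
theorem J_two_nonneg (hs : Simple M) (hG : G ⊆ gr M) (hr : M.eRk (G : Set α) = 4) : 0 ≤ J M G 2 := by
  have hg4 := four_le_card_of_eRk_eq_four hr
  by_cases h9 : 9 ≤ G.card
  · exact J_two_nonneg_of_nine_le hs hG hr h9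
  push Not at h9
  rw [J_two_eq']
  have hσ := sum_sigma_ge hs hG hr
  have hDF := DF_two_ge (M := M) hG hr
  have hI := I4_le_choose (M := M) G
  have hI0 : (0 : ℚ) ≤ I4 M G := Nat.cast_nonneg _
  obtain ⟨c, hc⟩ : ∃ c, G.card = c + 4 := ⟨G.card - 4, by omega⟩
  rw [hc, Nat.add_sub_cancel] at hσ
  rw [hc] at hI hDF
  rcases (show c = 0 ∨ c = 1 ∨ c = 2 ∨ c = 3 ∨ c = 4 by omega) with h | h | h | h | h <;> subst h
  · -- `g = 4`: `m(G) = 4`, `DF₂ ≥ 1`, `I₄ ≤ 1`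
    have hm : mTr M G = 4 := mTr_eq_four_of_card_eq_four hr hc
    rw [hm] at hDF
    have hDF' : (1 : ℚ) ≤ DF M G 2 := by exact_mod_cast (show 1 ≤ DF M G 2 by omega)
    have hI' : (I4 M G : ℚ) ≤ 1 := by exact_mod_cast hI.trans (by decide)
    rw [show Nat.choose 0 1 = 0 by decide, show Nat.choose 0 2 = 0 by decide] at hσ
    push_cast at hσ
    nlinarith
  · have hm := mTr_le_two_of_five_le hs hG hr (by omega)
    have hDF' : (4 : ℚ) ≤ DF M G 2 := by exact_mod_cast (show 4 ≤ DF M G 2 by omega)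
    have hI' : (I4 M G : ℚ) ≤ 5 := by exact_mod_cast hI.trans (by decide)
    rw [show Nat.choose 1 1 = 1 by decide, show Nat.choose 1 2 = 0 by decide] at hσ
    push_cast at hσ
    nlinarith
  · have hm := mTr_le_two_of_five_le hs hG hr (by omega)
    have hDF' : (5 : ℚ) ≤ DF M G 2 := by exact_mod_cast (show 5 ≤ DF M G 2 by omega)
    have hI' : (I4 M G : ℚ) ≤ 15 := by exact_mod_cast hI.trans (by decide)
    rw [show Nat.choose 2 1 = 2 by decide, show Nat.choose 2 2 = 1 by decide] at hσ
    push_cast at hσ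
    nlinarith
  · have hm := mTr_le_two_of_five_le hs hG hr (by omega)
    have hDF' : (6 : ℚ) ≤ DF M G 2 := by exact_mod_cast (show 6 ≤ DF M G 2 by omega)
    have hI' : (I4 M G : ℚ) ≤ 35 := by exact_mod_cast hI.trans (by decide)
    rw [show Nat.choose 3 1 = 3 by decide, show Nat.choose 3 2 = 3 by decide] at hσ
    push_cast at hσ
    nlinarith
  · have hm := mTr_le_two_of_five_le hs hG hr (by omega)
    have hDF' : (7 : ℚ) ≤ DF M G 2 := by exact_mod_cast (show 7 ≤ DF M G 2 by omega)
    have hI' : (I4 M G : ℚ) ≤ 70 := by exact_mod_cast hI.trans (by decide)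
    rw [show Nat.choose 4 1 = 4 by decide, show Nat.choose 4 2 = 6 by decide] at hσ
    push_cast at hσ
    nlinarith

end PercRepro.SixFour
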